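import Mathlib
import Summits.Ventures.PercRepro2.Defs
import Summits.Ventures.PercRepro2.Independence
import Summits.Ventures.PercRepro2.Harris
import Summits.Ventures.PercRepro2.Graph
import Summits.Ventures.PercRepro2.Events
import Summits.Ventures.PercRepro2.Induced
import Summits.Ventures.PercRepro2.BHKEvents
import Summits.Ventures.PercRepro2.BHKAvoid
import Summits.Ventures.PercRepro2.BHKAntitone
import Summits.Ventures.PercRepro2.BHKAntitoneCross

/-!
# The provable log-supermodular pairs of the three-status law (blind cell PercRepro2, mine-1 g51;
paper proofs/MINE1-LSMPAIRS.md §6)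

On `{s ↮ t}` every vertex has a status `T` (in `C_t`), `N` (in neither cluster) or `S` (in `C_s`);
for cells `a, b` of the status grid (incomparable in the product order `T < N < S`) the
LOG-SUPERMODULAR PAIR inequality is `m(a) m(b) ≤ m(a ∨ b) m(a ∧ b)` with `m(c) = P(σ = c, s ↮ t)`.
Of the 24 symmetry classes of such pairs (three observed vertices, or two), 12 survive every
census, climb and tropical test of the lane (paper §3), and nine of them are instances of the
two-cluster four-functions inequality `bhk_two_cluster_four'` (`BHKAntitoneCross.lean`), read
through the exploration of the cluster of `s` or of `t`.  This file states those nine in the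
cell's vocabulary (`clusterInEvent`, `avoidAll`) and proves each by one application of the
corollary — the proof of each is the SAME five lines; the content is the choice of the explored
root and of the families (`𝓤` = what the explored cluster hits, `𝓥` = what the other cluster
hits, `𝓦` = what it avoids, `X` = what the explored cluster avoids).

Reading of the statements (vertices `a, b, c`, resp. `y, z`, distinct from `s, t` and from each
other): `clusterInEvent ends s {K | c ∈ K ∧ a ∉ K ∧ b ∉ K} ∩ avoidAll ends t {a, b, c, s}` is the
cell `σ = (N, N, S)` on `{s ↮ t}` (the cluster of `t` avoids `a, b, c` and `s`; the cluster of `s`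
contains `c` and not `a, b`), and so on; a vertex hit by the explored cluster is automatically
avoided by the other one (`s ↮ t`), which is why the avoided sets `X, Y` of the corollary always
contain every observed vertex not hit by the explored cluster.
-/

namespace Summit.Ventures.PercRepro2

open BHKAntitoneCross

namespace LSMPairs

section LSMPairs

variable {V : Type*} {E : Type*} [Fintype E] [DecidableEq E] [Fintype V] [DecidableEq V]
  {R : Type*} [CommRing R] [LinearOrder R] [IsStrictOrderedRing R]

omit [Fintype E] [DecidableEq E] [Fintype V] [DecidableEq V] in
/-- `{K | v ∈ K}` is an up-set. -/
lemma isUpperSet_hit (v : V) : IsUpperSet {K : Set V | v ∈ K} := fun _ _ h hK => h hK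

omit [Fintype E] [DecidableEq E] [Fintype V] [DecidableEq V] in
/-- `{K | u ∈ K ∧ v ∈ K}` is an up-set. -/
lemma isUpperSet_hit2 (u v : V) : IsUpperSet {K : Set V | u ∈ K ∧ v ∈ K} :=
  fun _ _ h hK => ⟨h hK.1, h hK.2⟩

omit [Fintype E] [DecidableEq E] [Fintype V] [DecidableEq V] in
/-- `{K | v ∉ K}` is a down-set. -/
lemma isLowerSet_miss (v : V) : IsLowerSet {K : Set V | v ∉ K} := fun _ _ h hK hv => hK (h hv)

omit [Fintype E] [DecidableEq E] [Fintype V] [DecidableEq V] in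
/-- `{K | u ∉ K ∧ v ∉ K}` is a down-set. -/
lemma isLowerSet_miss2 (u v : V) : IsLowerSet {K : Set V | u ∉ K ∧ v ∉ K} :=
  fun _ _ h hK => ⟨fun hu => hK.1 (h hu), fun hv => hK.2 (h hv)⟩

omit [Fintype E] [DecidableEq E] [Fintype V] [DecidableEq V] in
/-- `{C ∈ univ}` is the sure event. -/
lemma clusterInEvent_univ (ends : E → Sym2 V) (x : V) :
    clusterInEvent ends x Set.univ = Set.univ := by
  ext ω; simp [clusterInEvent]

/-- **(LSM NNS, SSN)**: `m(NNS) m(SSN) ≤ m(SSS) m(NNN)` — explore `C_t`: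
`P(c ∈ C_s, a,b ∉ C_s, t ↮ {a,b,c,s}) · P(a,b ∈ C_s, c ∉ C_s, t ↮ {a,b,c,s})
  ≤ P(a,b,c ∉ C_s, t ↮ {a,b,c,s}) · P(a,b,c ∈ C_s, t ↮ {a,b,c,s})`. -/
theorem lsm_NNS_SSN (p : E → R) (hp : IsProbVec p) (ends : E → Sym2 V) (s t a b c : V) :
    prob p (clusterInEvent ends s ({K | c ∈ K} ∩ {K | a ∉ K ∧ b ∉ K}) ∩
        avoidAll ends t {a, b, c, s}) *
      prob p (clusterInEvent ends s ({K | a ∈ K ∧ b ∈ K} ∩ {K | c ∉ K}) ∩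
        avoidAll ends t {a, b, c, s}) ≤
    prob p (clusterInEvent ends s ({K | a ∉ K ∧ b ∉ K} ∩ {K | c ∉ K}) ∩
        avoidAll ends t {a, b, c, s}) *
      prob p (clusterInEvent ends s ({K | c ∈ K} ∩ {K | a ∈ K ∧ b ∈ K}) ∩
        avoidAll ends t {a, b, c, s}) := by
  have hs : s ∈ ({a, b, c, s} : Finset V) := by simp
  have h := bhk_two_cluster_four' p hp ends t s hs hs (𝓤₁ := Set.univ) (𝓤₂ := Set.univ)
    isUpperSet_univ isUpperSet_univ (isUpperSet_hit c) (isUpperSet_hit2 a b)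
    (isLowerSet_miss2 a b) (isLowerSet_miss c)
  simpa only [clusterInEvent_univ, Set.univ_inter, Finset.inter_self, Finset.union_self] using h

/-- **(LSM NNS, SST)**: `m(NNS) m(SST) ≤ m(NNT) m(SSS)` — explore `C_t`:
`P(c ∈ C_s, a,b ∉ C_s, t ↮ {a,b,c,s}) · P(c ∈ C_t, a,b ∈ C_s, t ↮ {a,b,s})
  ≤ P(c ∈ C_t, a,b ∉ C_s, t ↮ {a,b,s}) · P(a,b,c ∈ C_s, t ↮ {a,b,c,s})`. -/
theorem lsm_NNS_SST (p : E → R) (hp : IsProbVec p) (ends : E → Sym2 V) (s t a b c : V) :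
    prob p (clusterInEvent ends s ({K | c ∈ K} ∩ {K | a ∉ K ∧ b ∉ K}) ∩
        avoidAll ends t {a, b, c, s}) *
      prob p (clusterInEvent ends t {L | c ∈ L} ∩ clusterInEvent ends s ({K | a ∈ K ∧ b ∈ K} ∩
        Set.univ) ∩ avoidAll ends t {a, b, s}) ≤
    prob p (clusterInEvent ends t {L | c ∈ L} ∩ clusterInEvent ends s ({K | a ∉ K ∧ b ∉ K} ∩
        Set.univ) ∩ avoidAll ends t ({a, b, c, s} ∩ {a, b, s})) *
      prob p (clusterInEvent ends s ({K | c ∈ K} ∩ {K | a ∈ K ∧ b ∈ K}) ∩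
        avoidAll ends t ({a, b, c, s} ∪ {a, b, s})) := by
  have hs1 : s ∈ ({a, b, c, s} : Finset V) := by simp
  have hs2 : s ∈ ({a, b, s} : Finset V) := by simp
  have h := bhk_two_cluster_four' p hp ends t s hs1 hs2 (𝓤₁ := Set.univ) (𝓤₂ := {L | c ∈ L})
    isUpperSet_univ (isUpperSet_hit c) (isUpperSet_hit c) (isUpperSet_hit2 a b)
    (isLowerSet_miss2 a b) isLowerSet_univ
  simpa only [clusterInEvent_univ, Set.univ_inter] using h

/-- **(LSM NS, SN)** (two observed vertices; also positive association in the box `R_{yz}`):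
`P(z ∈ C_s, y ∉ C_s, t ↮ {y,z,s}) · P(y ∈ C_s, z ∉ C_s, t ↮ {y,z,s})
  ≤ P(y,z ∉ C_s, t ↮ {y,z,s}) · P(y,z ∈ C_s, t ↮ {y,z,s})`. -/
theorem lsm_NS_SN (p : E → R) (hp : IsProbVec p) (ends : E → Sym2 V) (s t y z : V) :
    prob p (clusterInEvent ends s ({K | z ∈ K} ∩ {K | y ∉ K}) ∩ avoidAll ends t {y, z, s}) *
      prob p (clusterInEvent ends s ({K | y ∈ K} ∩ {K | z ∉ K}) ∩ avoidAll ends t {y, z, s}) ≤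
    prob p (clusterInEvent ends s ({K | y ∉ K} ∩ {K | z ∉ K}) ∩ avoidAll ends t {y, z, s}) *
      prob p (clusterInEvent ends s ({K | z ∈ K} ∩ {K | y ∈ K}) ∩ avoidAll ends t {y, z, s}) := by
  have hs : s ∈ ({y, z, s} : Finset V) := by simp
  have h := bhk_two_cluster_four' p hp ends t s hs hs (𝓤₁ := Set.univ) (𝓤₂ := Set.univ)
    isUpperSet_univ isUpperSet_univ (isUpperSet_hit z) (isUpperSet_hit y)
    (isLowerSet_miss y) (isLowerSet_miss z)
  simpa only [clusterInEvent_univ, Set.univ_inter, Finset.inter_self, Finset.union_self] using h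

/-- **(LSM NS, ST)**: `m(NS) m(ST) ≤ m(NT) m(SS)` — explore `C_t`:
`P(z ∈ C_s, y ∉ C_s, t ↮ {y,z,s}) · P(z ∈ C_t, y ∈ C_s, t ↮ {y,s})
  ≤ P(z ∈ C_t, y ∉ C_s, t ↮ {y,s}) · P(y,z ∈ C_s, t ↮ {y,z,s})`. -/
theorem lsm_NS_ST (p : E → R) (hp : IsProbVec p) (ends : E → Sym2 V) (s t y z : V) :
    prob p (clusterInEvent ends s ({K | z ∈ K} ∩ {K | y ∉ K}) ∩ avoidAll ends t {y, z, s}) *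
      prob p (clusterInEvent ends t {L | z ∈ L} ∩ clusterInEvent ends s ({K | y ∈ K} ∩ Set.univ) ∩
        avoidAll ends t {y, s}) ≤
    prob p (clusterInEvent ends t {L | z ∈ L} ∩ clusterInEvent ends s ({K | y ∉ K} ∩ Set.univ) ∩
        avoidAll ends t {y, s}) *
      prob p (clusterInEvent ends s ({K | z ∈ K} ∩ {K | y ∈ K}) ∩ avoidAll ends t {y, z, s}) := by
  have hs1 : s ∈ ({y, z, s} : Finset V) := by simp
  have hs2 : s ∈ ({y, s} : Finset V) := by simp
  have e1 : ({y, z, s} : Finset V) ∩ {y, s} = {y, s} := by ext x; simp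
  have e2 : ({y, z, s} : Finset V) ∪ {y, s} = {y, z, s} := by ext x; simp
  have h := bhk_two_cluster_four' p hp ends t s hs1 hs2 (𝓤₁ := Set.univ) (𝓤₂ := {L | z ∈ L})
    isUpperSet_univ (isUpperSet_hit z) (isUpperSet_hit z) (isUpperSet_hit y)
    (isLowerSet_miss y) isLowerSet_univ
  rw [e1, e2] at h
  simpa only [clusterInEvent_univ, Set.univ_inter] using h

/-- **(LSM NSS, SNT)**: `m(NSS) m(SNT) ≤ m(NNT) m(SSS)` — explore `C_t`:
`P(b,c ∈ C_s, a ∉ C_s, t ↮ {a,b,c,s}) · P(c ∈ C_t, a ∈ C_s, b ∉ C_s, t ↮ {a,b,s})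
  ≤ P(c ∈ C_t, a,b ∉ C_s, t ↮ {a,b,s}) · P(a,b,c ∈ C_s, t ↮ {a,b,c,s})`. -/
theorem lsm_NSS_SNT (p : E → R) (hp : IsProbVec p) (ends : E → Sym2 V) (s t a b c : V) :
    prob p (clusterInEvent ends s ({K | b ∈ K ∧ c ∈ K} ∩ {K | a ∉ K}) ∩
        avoidAll ends t {a, b, c, s}) *
      prob p (clusterInEvent ends t {L | c ∈ L} ∩ clusterInEvent ends s ({K | a ∈ K} ∩ {K | b ∉ K}) ∩
        avoidAll ends t {a, b, s}) ≤
    prob p (clusterInEvent ends t {L | c ∈ L} ∩ clusterInEvent ends s ({K | a ∉ K} ∩ {K | b ∉ K}) ∩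
        avoidAll ends t {a, b, s}) *
      prob p (clusterInEvent ends s ({K | b ∈ K ∧ c ∈ K} ∩ {K | a ∈ K}) ∩
        avoidAll ends t {a, b, c, s}) := by
  have hs1 : s ∈ ({a, b, c, s} : Finset V) := by simp
  have hs2 : s ∈ ({a, b, s} : Finset V) := by simp
  have e1 : ({a, b, c, s} : Finset V) ∩ {a, b, s} = {a, b, s} := by ext x; simp
  have e2 : ({a, b, c, s} : Finset V) ∪ {a, b, s} = {a, b, c, s} := by ext x; simp
  have h := bhk_two_cluster_four' p hp ends t s hs1 hs2 (𝓤₁ := Set.univ) (𝓤₂ := {L | c ∈ L})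
    isUpperSet_univ (isUpperSet_hit c) (isUpperSet_hit2 b c) (isUpperSet_hit a)
    (isLowerSet_miss a) (isLowerSet_miss b)
  rw [e1, e2] at h
  simpa only [clusterInEvent_univ, Set.univ_inter] using h

/-- **(LSM NSS, STT)**: `m(NSS) m(STT) ≤ m(NTT) m(SSS)` — explore `C_t`:
`P(b,c ∈ C_s, a ∉ C_s, t ↮ {a,b,c,s}) · P(b,c ∈ C_t, a ∈ C_s, t ↮ {a,s})
  ≤ P(b,c ∈ C_t, a ∉ C_s, t ↮ {a,s}) · P(a,b,c ∈ C_s, t ↮ {a,b,c,s})`. -/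
theorem lsm_NSS_STT (p : E → R) (hp : IsProbVec p) (ends : E → Sym2 V) (s t a b c : V) :
    prob p (clusterInEvent ends s ({K | b ∈ K ∧ c ∈ K} ∩ {K | a ∉ K}) ∩
        avoidAll ends t {a, b, c, s}) *
      prob p (clusterInEvent ends t {L | b ∈ L ∧ c ∈ L} ∩
        clusterInEvent ends s ({K | a ∈ K} ∩ Set.univ) ∩ avoidAll ends t {a, s}) ≤
    prob p (clusterInEvent ends t {L | b ∈ L ∧ c ∈ L} ∩
        clusterInEvent ends s ({K | a ∉ K} ∩ Set.univ) ∩ avoidAll ends t {a, s}) *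
      prob p (clusterInEvent ends s ({K | b ∈ K ∧ c ∈ K} ∩ {K | a ∈ K}) ∩
        avoidAll ends t {a, b, c, s}) := by
  have hs1 : s ∈ ({a, b, c, s} : Finset V) := by simp
  have hs2 : s ∈ ({a, s} : Finset V) := by simp
  have e1 : ({a, b, c, s} : Finset V) ∩ {a, s} = {a, s} := by ext x; simp
  have e2 : ({a, b, c, s} : Finset V) ∪ {a, s} = {a, b, c, s} := by ext x; simp
  have h := bhk_two_cluster_four' p hp ends t s hs1 hs2 (𝓤₁ := Set.univ)
    (𝓤₂ := {L | b ∈ L ∧ c ∈ L}) isUpperSet_univ (isUpperSet_hit2 b c) (isUpperSet_hit2 b c)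
    (isUpperSet_hit a) (isLowerSet_miss a) isLowerSet_univ
  rw [e1, e2] at h
  simpa only [clusterInEvent_univ, Set.univ_inter] using h

/-- **(LSM NST, STS)**: `m(NST) m(STS) ≤ m(NTT) m(SSS)` — explore `C_t`:
`P(c ∈ C_t, b ∈ C_s, a ∉ C_s, t ↮ {a,b,s}) · P(b ∈ C_t, a,c ∈ C_s, t ↮ {a,c,s})
  ≤ P(b,c ∈ C_t, a ∉ C_s, t ↮ {a,b,s}∩{a,c,s}) · P(a,b,c ∈ C_s, t ↮ {a,b,s}∪{a,c,s})`
(for distinct `a, b, c`: `{a,b,s} ∩ {a,c,s} = {a,s}`, `{a,b,s} ∪ {a,c,s} = {a,b,c,s}`). -/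
theorem lsm_NST_STS (p : E → R) (hp : IsProbVec p) (ends : E → Sym2 V) (s t a b c : V) :
    prob p (clusterInEvent ends t {L | c ∈ L} ∩ clusterInEvent ends s ({K | b ∈ K} ∩ {K | a ∉ K}) ∩
        avoidAll ends t {a, b, s}) *
      prob p (clusterInEvent ends t {L | b ∈ L} ∩
        clusterInEvent ends s ({K | a ∈ K ∧ c ∈ K} ∩ Set.univ) ∩ avoidAll ends t {a, c, s}) ≤
    prob p (clusterInEvent ends t ({L | c ∈ L} ∩ {L | b ∈ L}) ∩
        clusterInEvent ends s ({K | a ∉ K} ∩ Set.univ) ∩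
        avoidAll ends t ({a, b, s} ∩ {a, c, s})) *
      prob p (clusterInEvent ends s ({K | b ∈ K} ∩ {K | a ∈ K ∧ c ∈ K}) ∩
        avoidAll ends t ({a, b, s} ∪ {a, c, s})) := by
  have hs1 : s ∈ ({a, b, s} : Finset V) := by simp
  have hs2 : s ∈ ({a, c, s} : Finset V) := by simp
  exact bhk_two_cluster_four' p hp ends t s hs1 hs2 (𝓤₁ := {L | c ∈ L}) (𝓤₂ := {L | b ∈ L})
    (isUpperSet_hit c) (isUpperSet_hit b) (isUpperSet_hit b) (isUpperSet_hit2 a c)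
    (isLowerSet_miss a) isLowerSet_univ

/-- **(LSM SST, TTS)**: `m(SST) m(TTS) ≤ m(SSS) m(TTT)` — explore `C_s` (pure antitone case):
`P(a,b ∈ C_s, c ∈ C_t, s ↮ {c,t}) · P(c ∈ C_s, a,b ∈ C_t, s ↮ {a,b,t})
  ≤ P(a,b,c ∈ C_s, s ↮ {c,t}∩{a,b,t}) · P(a,b,c ∈ C_t, s ↮ {c,t}∪{a,b,t})`
(for distinct `a, b, c`: `{c,t} ∩ {a,b,t} = {t}`, `{c,t} ∪ {a,b,t} = {a,b,c,t}`). -/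
theorem lsm_SST_TTS (p : E → R) (hp : IsProbVec p) (ends : E → Sym2 V) (s t a b c : V) :
    prob p (clusterInEvent ends s {K | a ∈ K ∧ b ∈ K} ∩ clusterInEvent ends t {L | c ∈ L} ∩
        avoidAll ends s {c, t}) *
      prob p (clusterInEvent ends s {K | c ∈ K} ∩ clusterInEvent ends t {L | a ∈ L ∧ b ∈ L} ∩
        avoidAll ends s {a, b, t}) ≤
    prob p (clusterInEvent ends s ({K | a ∈ K ∧ b ∈ K} ∩ {K | c ∈ K}) ∩
        avoidAll ends s ({c, t} ∩ {a, b, t})) *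
      prob p (clusterInEvent ends t ({L | c ∈ L} ∩ {L | a ∈ L ∧ b ∈ L}) ∩
        avoidAll ends s ({c, t} ∪ {a, b, t})) := by
  have ht1 : t ∈ ({c, t} : Finset V) := by simp
  have ht2 : t ∈ ({a, b, t} : Finset V) := by simp
  exact bhk_two_cluster_four p hp ends s t ht1 ht2 (isUpperSet_hit2 a b) (isUpperSet_hit c)
    (isUpperSet_hit c) (isUpperSet_hit2 a b)

end LSMPairs

end LSMPairs

end Summit.Ventures.PercRepro2
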